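import Mathlib
import Literature.Analysis.OperatorTheory.BandedFirstOrderEigenvectorRegularity
import Summits.NavierStokesRegularity.FluidComputer.SkewCutGalerkinMaster

/-!
# THEOREM 3-B-NESTED from matrix data: the certified eigenpair IN COORDINATES and its `H^∞`
regularity (profile-cert-3 g5, cell `ns-blowup`, 2026-08-26)

HONEST FRAMING (human rulings D-0035/D-0074): nothing here is a claim about Navier–Stokes blow-up.
WHAT THIS IS NOT: not NS evidence. MODEL lane bookkeeping. The END-TO-END statement
`BorderedEigenpairFromSections.certified_eigenpair_of_sections_nested` (p465285) delivers the certified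
eigenpair of a 3-B-NESTED row in RESOLVENT COORDINATES: `λ⋆ ∈ 𝕜` and `w⋆` with `R_λ⋆ w⋆ = 0`,
`R_z = 1 − T − (x₀ − z) S₀`, `S₀ = diag(d)`, `d_i (x₀ − ℓ_i) = 1`, the eigenvector being `v⋆ = S₀ w⋆`.
This file reads that clause the way the synthesis door of the model expects it (instab3's
`isLinNSEigenvalue_abcFlow_of_crossForm` + `LatticeSqWeightsRapidDecay`; GROUP A's
`SkewCutGalerkinMaster.exists_smooth_eigenvector_Ioo`, whose Steps 2–5 are exactly re-run here for an
arbitrary — possibly complex, class I — eigenvalue):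

* `eigen_coord_of_resolventCoord`: `R_λ w = 0` ⇒ `ℓ_i v_i + Σ_{j ∈ nbr i} a_ij v_j = λ v_i` for every
  `i` (`v_i = ⟪b i, S₀ w⟫`, `a_ij = ⟪b i, T b j⟫ (x₀ − ℓ_j)`, `T` banded) — the eigen-equation of
  `L₀ + A` mode by mode;
* `summable_weights_of_resolventCoord`: with the first-order growth `|a_ij| ≤ K w_j`, comparable
  weights along the band and `‖d_i‖ w_i ≤ M` (the shapes of instab4's master theorem), every such
  eigenvector has `Σ_i w_i^{2s} |v_i|² < ∞` for ALL `s` (the tree's two-step bootstrap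
  `FirstOrderBand.summable_weighted_of_eigen`, p442454): the certified eigenvector is `H^∞` in
  coefficients.

Mathlib + `BandedFirstOrderEigenvectorRegularity` + `SkewCutGalerkinMaster`; no new definitions.
bears_on LADDER-NS N5 / Z4-a(1)(2); evidence-only for `EpisodeBase` (stmt-NavierStokesRegularity-19179).
[folklore] / [cite: Evans2010, §6.3.1 Thm 3] for the bootstrap.
-/

noncomputable section

namespace Summit.NavierStokesRegularity.FluidComputer.BorderedEigenpairFromSectionsCoord

open scoped InnerProductSpace

variable {𝕜 H : Type*} [RCLike 𝕜] [NormedAddCommGroup H] [InnerProductSpace 𝕜 H] [CompleteSpace H]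
variable {ι : Type*} (b : HilbertBasis ι 𝕜 H)

/-- **The certified eigenpair in coordinates.** `S₀ = diag(d)`, `d_i (x₀ − ℓ_i) = 1`, `T` with a banded
matrix; if `R_λ w = 0` (`R_λ = 1 − T − (x₀ − λ) S₀`), then `v = S₀ w` satisfies
`ℓ_i v_i + Σ_{j ∈ nbr i} a_ij v_j = λ v_i` for every `i`, `a_ij = ⟪b i, T b j⟫ (x₀ − ℓ_j)`. -/
theorem eigen_coord_of_resolventCoord (ℓ : ι → ℝ) (x₀ : ℝ) (d : lp (fun _ : ι => 𝕜) ⊤)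
    (hd : ∀ i, d i * ((x₀ : 𝕜) - (ℓ i : 𝕜)) = 1) (T : H →L[𝕜] H) (nbr : ι → Finset ι)
    (ht0 : ∀ i j, j ∉ nbr i → ⟪b i, T (b j)⟫_𝕜 = 0) (lam : 𝕜) {w : H}
    (hw : ((1 : H →L[𝕜] H) - T - ((x₀ : 𝕜) - lam) • b.diagonalCLM d) w = 0) (i : ι) :
    (ℓ i : 𝕜) * ⟪b i, b.diagonalCLM d w⟫_𝕜 +
        ∑ j ∈ nbr i, (⟪b i, T (b j)⟫_𝕜 * ((x₀ : 𝕜) - (ℓ j : 𝕜))) * ⟪b j, b.diagonalCLM d w⟫_𝕜 =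
      lam * ⟪b i, b.diagonalCLM d w⟫_𝕜 := by
  set v : H := b.diagonalCLM d w with hv
  have hvi : ∀ i, ⟪b i, v⟫_𝕜 = d i * ⟪b i, w⟫_𝕜 := fun i =>
    SkewCutGalerkinMaster.inner_basis_diagonalCLM b d w i
  have hwi : ∀ i, ⟪b i, w⟫_𝕜 = ((x₀ : 𝕜) - (ℓ i : 𝕜)) * ⟪b i, v⟫_𝕜 := fun i => by
    rw [hvi, ← mul_assoc, mul_comm ((x₀ : 𝕜) - (ℓ i : 𝕜)), hd, one_mul]
  have h := congrArg (fun z => ⟪b i, z⟫_𝕜) hw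
  simp only [sub_apply, FunLike.coe_smul, Pi.smul_apply, one_apply_eq_self, inner_sub_right,
    inner_smul_right, inner_zero_right] at h
  rw [SkewCutGalerkinMaster.inner_basis_map_eq_sum b T nbr ht0 w i, hwi i] at h
  have hsum : ∑ j ∈ nbr i, ⟪b i, T (b j)⟫_𝕜 * ⟪b j, w⟫_𝕜 =
      ∑ j ∈ nbr i, (⟪b i, T (b j)⟫_𝕜 * ((x₀ : 𝕜) - (ℓ j : 𝕜))) * ⟪b j, v⟫_𝕜 :=
    Finset.sum_congr rfl fun j _ => by rw [hwi j, mul_assoc]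
  rw [hsum, ← hv] at h
  linear_combination -h

/-- **`H^∞` regularity of the certified eigenvector.** In the setting of
`eigen_coord_of_resolventCoord`, with weights `0 ≤ w_i`, `w_i² ≤ 1 + |ℓ_i|`, the first-order growth
`|a_ij| ≤ K w_j` on a symmetric band of width `≤ W`, comparable weights `w_i ≤ L w_j` along the band,
and `‖d_i‖ w_i ≤ M`: if `R_λ w = 0` then `Σ_i w_i^{2s} |⟪b i, S₀ w⟫|² < ∞` for every `s`
(`v = S₀ w` lies in the form domain because `‖d_i‖ w_i ≤ M`, then the two-step bootstrap). -/
theorem summable_weights_of_resolventCoord (ℓ : ι → ℝ) (x₀ : ℝ) (d : lp (fun _ : ι => 𝕜) ⊤)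
    (hd : ∀ i, d i * ((x₀ : 𝕜) - (ℓ i : 𝕜)) = 1) (T : H →L[𝕜] H) (nbr : ι → Finset ι)
    (hsymm : ∀ i j, j ∈ nbr i ↔ i ∈ nbr j) {W : ℕ} (hW : ∀ i, (nbr i).card ≤ W)
    (ht0 : ∀ i j, j ∉ nbr i → ⟪b i, T (b j)⟫_𝕜 = 0)
    (wgt : ι → ℝ) (hw0 : ∀ i, 0 ≤ wgt i) (hwℓ : ∀ i, wgt i ^ 2 ≤ 1 + |ℓ i|)
    {K : ℝ} (hK : 0 ≤ K)
    (ha : ∀ i j, j ∈ nbr i → ‖⟪b i, T (b j)⟫_𝕜 * ((x₀ : 𝕜) - (ℓ j : 𝕜))‖ ≤ K * wgt j)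
    {L : ℝ} (hLnn : 0 ≤ L) (hL : ∀ i j, j ∈ nbr i → wgt i ≤ L * wgt j)
    {M : ℝ} (hM : ∀ i, ‖d i‖ * wgt i ≤ M) (lam : 𝕜) {w : H}
    (hw : ((1 : H →L[𝕜] H) - T - ((x₀ : 𝕜) - lam) • b.diagonalCLM d) w = 0) (s : ℕ) :
    Summable fun i => wgt i ^ (2 * s) * ‖⟪b i, b.diagonalCLM d w⟫_𝕜‖ ^ 2 := by
  set v : H := b.diagonalCLM d w with hv
  have hvi : ∀ i, ⟪b i, v⟫_𝕜 = d i * ⟪b i, w⟫_𝕜 := fun i =>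
    SkewCutGalerkinMaster.inner_basis_diagonalCLM b d w i
  have heig := eigen_coord_of_resolventCoord b ℓ x₀ d hd T nbr ht0 lam hw
  -- form-level energy of `v = S₀ w` is finite
  have h1 : Summable fun i => wgt i ^ 2 * ‖⟪b i, v⟫_𝕜‖ ^ 2 := by
    have hpar : Summable fun i => ‖⟪b i, w⟫_𝕜‖ ^ 2 := by
      have h := (b.hasSum_inner_mul_inner w w).summable.norm
      refine h.congr fun i => ?_
      rw [norm_mul, ← inner_conj_symm, RCLike.norm_conj, sq]
    refine Summable.of_nonneg_of_le (fun i => mul_nonneg (sq_nonneg _) (sq_nonneg _)) (fun i => ?_)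
      (hpar.mul_left (M ^ 2))
    rw [hvi, norm_mul, mul_pow, ← mul_assoc]
    refine mul_le_mul_of_nonneg_right ?_ (sq_nonneg _)
    calc wgt i ^ 2 * ‖d i‖ ^ 2 = (‖d i‖ * wgt i) ^ 2 := by ring
      _ ≤ M ^ 2 := pow_le_pow_left₀ (mul_nonneg (norm_nonneg _) (hw0 i)) (hM i) 2
  exact Literature.Analysis.OperatorTheory.FirstOrderBand.summable_weighted_of_eigen (e := b)
    (w := wgt) (ℓ := ℓ) (nbr := nbr) (a := fun i j => ⟪b i, T (b j)⟫_𝕜 * ((x₀ : 𝕜) - (ℓ j : 𝕜)))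
    (f := v) (lam := lam) hw0 hwℓ hK ha hsymm hW hLnn hL heig h1 s

omit [CompleteSpace H] in
/-- **Normalisation in coordinates.** `‖S₀ w‖² = Σ_i |⟪b i, S₀ w⟫|²` (Parseval) — the certified
`‖v⋆ − ṽ‖ ≤ ρ` and `⟨ṽ_h, v⋆⟩ = ⟨ṽ_h, ṽ⟩` are statements about this coefficient family. -/
theorem hasSum_norm_sq_coord (x : H) : HasSum (fun i => ‖⟪b i, x⟫_𝕜‖ ^ 2) (‖x‖ ^ 2) := by
  have h := b.hasSum_inner_mul_inner x x
  have hre := RCLike.hasSum_re _ h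
  rw [← InnerProductSpace.norm_sq_eq_re_inner (𝕜 := 𝕜)] at hre
  refine hre.congr_fun fun i => ?_
  have hci : ⟪x, b i⟫_𝕜 = (starRingEnd 𝕜) ⟪b i, x⟫_𝕜 := (inner_conj_symm _ _).symm
  rw [hci, RCLike.conj_mul, ← RCLike.ofReal_pow, RCLike.ofReal_re]

end Summit.NavierStokesRegularity.FluidComputer.BorderedEigenpairFromSectionsCoord

end
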